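import Summits.QuantumFields.BalabanUV.T4Continuum.Support.NE7ConstrainedGreenIdentity
import HarnessLib

/-!
# NE7ConstrainedGreenGaugeSplit — THE ALGEBRAIC SKELETON OF THE TRANSFER «hard slice ⟸ soft rows» AT A CURVED BACKGROUND: for a gauge-fixed penalised operator
# `S = S₀ + D·Dᵀ + Qᵀ·A·Q` with Green operator `G = S⁻¹`, constrained Green operator `C = G − GQᵀ(QGQᵀ)⁻¹QG` and minimiser map `H = GQᵀ(QGQᵀ)⁻¹`, EVERY hard-slice
# solution `x ∈ ker Q`, `S₀x = h + Qᵀμ`, IS `x = C h + C D(Dᵀx)` EXACTLY, and for EVERY gauge parameter `σ`: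
# `x = C h + C D(Dᵀ(x + Dσ)) − (Dσ − H(Q Dσ)) + C(S₀ Dσ)` — the FOUR TERMS of the four-term slice-solver letter (source ∕ divergence ∕ known gauge part ∕ tension)
# (file 81 of the curved (APE), F151; pure linear algebra over a commutative ring, Mathlib + lineage #2's (140) only)

Cell `pub-balaban`, rung (B)+1 sub-cell t4, lineage `b2b-balaban-t4-ne7-p1` (CRUX PROVER NE7 #1 = OWNER of row NE7), generation 82; memo
`t4/b2b-balaban-t4-ne7-p1-g82/LOCALISATION-ROAD.md` §2(d).  Over lineage #2's (140) `NE7ConstrainedGreenIdentity` (`constrainedGreen`, `Q_constrainedGreen_apply`,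
`S_constrainedGreen_apply`; right inverses).  THIS file adds the LEFT-inverse half (`G·S = id`, `(QGQᵀ)⁻¹·(QGQᵀ) = id` — in finite dimensions the same hypotheses) and the
gauge-fixing term `D·Dᵀ` (`D` = covariant gradient of scalars, `Dᵀ` = covariant divergence; in the memo's packaging P2 `S = hess_W + D_WD_W^* + M⁻²Q_W^*Q_W`, `S₀ = hess_W`).
WHY.  The curved (APE) END consumes a slice-solver letter for ONE `W`-tangent field `x` (`Q x = 0`) whose Hessian functional on the tangent tests is a source `h`: in Lagrange form
`S₀x = h + Qᵀμ` ((138) at `W`: the annihilator of `ker Q` is `range Qᵀ`).  The memo's power counting (§2) says the ANALYTIC rows one can prove at a curved background by sup-norm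
localisation are rows of the SOFT operator `S` (all fields, local gauge fixing, `M⁻²`-mass) — `‖curl∘C‖`, `‖curl∘C∘D‖`, the minimiser row, the tension row — not a row of the hard
slice.  THIS file is the exact algebra that turns those four rows into the letter: §2 **`eq_source_add_gaugeFix`** `x = C h + C D(Dᵀx)` (the penalty AND the multiplier drop:
`C Qᵀ = 0`, `C S = id` on `ker Q`); §3 **`eq_fourTerm`** — for every `σ`, `x = C h + C D(Dᵀ(x + Dσ)) − (Dσ − H(Q(Dσ))) + C(S₀(Dσ))`: the divergence row sees only the
divergence of the RE-GAUGED field `x + Dσ` (the END knows its gauge part `σ̃`, memo O2), the third term is «a pure gauge minus the minimal extension of its coarse shadow»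
(after `curl_W`: `ad(flux)·σ` plus the minimiser's tension correction), the fourth is `C` applied to the tension functional `S₀(Dσ) = hess_W(D_Wσ, ·) = −dS_W([σ, ·])` (F133).
At the flat background `C D ≡` pure gauge and `curl C D ≡ 0`, `S₀ D = 0`: the letter is divergence-blind there, as lineage #2's (152) is.
WHAT ([folklore]; Mathlib-only linear algebra; 0 sorry; the one `def` is (140)'s `constrainedGreen`, nothing new defined).  §1 `constrainedGreen_Qt_apply` (`C Qᵀ = 0`),
`constrainedGreen_S_apply` (`C(Sy) = y − H(Qy)`), `constrainedGreen_S_apply_of_ker`, `S_minimiser_apply` (`S(Hf) = Qᵀ((QGQᵀ)⁻¹f) ∈ range Qᵀ`: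
the minimal-extension property); §2 `eq_source_add_gaugeFix`; §3 `constrainedGreen_gaugeFix_gauge`, **`eq_fourTerm`**; §4 `pairing_S0_sub_source_eq_zero` (weak reading: the
four-term right side solves the hard weak equation — consistency check).
HONEST FRAMING (page 1): [folklore] ring algebra of linear maps; NO estimate; the invertibility hypotheses (`S·G = G·S = id`, `(QGQᵀ)⁻¹` two-sided) are HYPOTHESES (for the
memo's `S` they are the IMS positivity of §1 there — not typed); nothing of Bałaban's asserted; (c₁) NOT proved; NOT (APE), NOT ONE-STEP, NOT NE7; spine 0∕9; finite T⁴ rung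
(B)+1 — NOT infinite volume, NOT mass gap, NOT `BetaPertH`, NOT Clay.  Continuum YM on T⁴ ⇐ BetaPertH ∧ nine spine estimates (0/9 proved); BetaPertH ⇐ (D1) ∧ (D4) ∧
CAP+tail; G-an2-4 gates asym, D1 and NE2/3/4.
-/

set_option autoImplicit false

namespace Summit.QuantumFields.BalabanUV.T4Continuum.NE7ConstrainedGreenGaugeSplit

open NE7ConstrainedGreenIdentity (constrainedGreen constrainedGreen_apply Q_constrainedGreen_apply S_constrainedGreen_apply)

variable {R : Type*} [CommRing R] {E F Sc : Type*} [AddCommGroup E] [Module R E] [AddCommGroup F] [Module R F] [AddCommGroup Sc] [Module R Sc]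

/-! ## §1 Left-inverse identities: `C·Qᵀ = 0`, `C·S = id − H·Q`, the minimiser map `H = G·Qᵀ·(QGQᵀ)⁻¹` -/

/-- **`C Qᵀ = 0`**: the constrained Green operator kills multiplier sources (needs the LEFT inverse `(QGQᵀ)⁻¹·(QGQᵀ) = id`). [folklore] -/
theorem constrainedGreen_Qt_apply (G : E →ₗ[R] E) (Q : E →ₗ[R] F) (Qt : F →ₗ[R] E) (Dinv : F →ₗ[R] F)
    (hD' : ∀ f : F, Dinv (Q (G (Qt f))) = f) (f : F) : constrainedGreen G Q Qt Dinv (Qt f) = 0 := by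
  rw [constrainedGreen_apply, hD', sub_self]

/-- **`C (S y) = y − H (Q y)`**, `H f = G (Qᵀ ((QGQᵀ)⁻¹ f))` (needs the LEFT inverse `G·S = id`). [folklore] -/
theorem constrainedGreen_S_apply (S G : E →ₗ[R] E) (Q : E →ₗ[R] F) (Qt : F →ₗ[R] E) (Dinv : F →ₗ[R] F) (hGS : ∀ x : E, G (S x) = x) (y : E) :
    constrainedGreen G Q Qt Dinv (S y) = y - G (Qt (Dinv (Q y))) := by
  rw [constrainedGreen_apply, hGS]

/-- **`C (S x) = x` on `ker Q`**. [folklore] -/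
theorem constrainedGreen_S_apply_of_ker (S G : E →ₗ[R] E) (Q : E →ₗ[R] F) (Qt : F →ₗ[R] E) (Dinv : F →ₗ[R] F) (hGS : ∀ x : E, G (S x) = x)
    {x : E} (hx : Q x = 0) : constrainedGreen G Q Qt Dinv (S x) = x := by
  rw [constrainedGreen_S_apply S G Q Qt Dinv hGS, hx, map_zero, map_zero, map_zero, sub_zero]

/-- **THE MINIMAL-EXTENSION PROPERTY**: `S (H f) = Qᵀ ((QGQᵀ)⁻¹ f)` — the field `H f` is `S`-orthogonal to `ker Q` (its `S`-image is a pure multiplier source), i.e. it is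
the critical point of `½⟨y, Sy⟩` on `{Q y = f}` (Bałaban's `H_k`). [folklore] -/
theorem S_minimiser_apply (S G : E →ₗ[R] E) (Qt : F →ₗ[R] E) (Dinv : F →ₗ[R] F) (hSG : ∀ x : E, S (G x) = x) (f : F) :
    S (G (Qt (Dinv f))) = Qt (Dinv f) := hSG _

/-- `S (H f) ∈ range Qᵀ`. [folklore] -/
theorem S_minimiser_mem_range (S G : E →ₗ[R] E) (Qt : F →ₗ[R] E) (Dinv : F →ₗ[R] F) (hSG : ∀ x : E, S (G x) = x) (f : F) :
    S (G (Qt (Dinv f))) ∈ LinearMap.range Qt := ⟨Dinv f, (S_minimiser_apply S G Qt Dinv hSG f).symm⟩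

/-! ## §2 The hard-slice solution through the soft Green operator: `x = C h + C D(Dᵀ x)` -/

/-- **THE TRANSFER IDENTITY.**  Let `S = S₀ + D·Dᵀ + Qᵀ·A·Q` (Hessian + gauge fixing + penalty) with two-sided Green operator `G` and two-sided `(QGQᵀ)⁻¹`.  If `x ∈ ker Q` solves
the hard-slice equation in Lagrange form `S₀ x = h + Qᵀ μ`, then `x = C h + C (D (Dᵀ x))` — the penalty and the multiplier drop. [folklore] -/
theorem eq_source_add_gaugeFix (S S₀ G : E →ₗ[R] E) (Q : E →ₗ[R] F) (Qt : F →ₗ[R] E) (A Dinv : F →ₗ[R] F) (D : Sc →ₗ[R] E) (Dt : E →ₗ[R] Sc)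
    (hS : ∀ y : E, S y = S₀ y + D (Dt y) + Qt (A (Q y))) (hGS : ∀ y : E, G (S y) = y) (hD' : ∀ f : F, Dinv (Q (G (Qt f))) = f)
    {x h : E} {μ : F} (hx : Q x = 0) (hsrc : S₀ x = h + Qt μ) :
    x = constrainedGreen G Q Qt Dinv h + constrainedGreen G Q Qt Dinv (D (Dt x)) := by
  have h1 := constrainedGreen_S_apply_of_ker S G Q Qt Dinv hGS hx
  rw [hS, hsrc, hx, map_zero, map_zero, add_zero, map_add, map_add, constrainedGreen_Qt_apply G Q Qt Dinv hD', add_zero] at h1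
  exact h1.symm

/-! ## §3 The gauge split: the four terms -/

/-- **`C D Dᵀ (D σ) = (D σ − H(Q(D σ))) − C(S₀(D σ))`**: the gauge-fixing operator on a pure gauge, through `C`, is the pure gauge minus the minimal extension of its coarse
shadow, minus `C` of its (tension) `S₀`-image. [folklore] -/
theorem constrainedGreen_gaugeFix_gauge (S S₀ G : E →ₗ[R] E) (Q : E →ₗ[R] F) (Qt : F →ₗ[R] E) (A Dinv : F →ₗ[R] F) (D : Sc →ₗ[R] E) (Dt : E →ₗ[R] Sc)
    (hS : ∀ y : E, S y = S₀ y + D (Dt y) + Qt (A (Q y))) (hGS : ∀ y : E, G (S y) = y) (hD' : ∀ f : F, Dinv (Q (G (Qt f))) = f) (σ : Sc) :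
    constrainedGreen G Q Qt Dinv (D (Dt (D σ)))
      = (D σ - G (Qt (Dinv (Q (D σ))))) - constrainedGreen G Q Qt Dinv (S₀ (D σ)) := by
  have h1 := constrainedGreen_S_apply S G Q Qt Dinv hGS (D σ)
  rw [hS, map_add, map_add, constrainedGreen_Qt_apply G Q Qt Dinv hD', add_zero] at h1
  -- `h1 : C (S₀ (Dσ)) + C (D (Dt (Dσ))) = Dσ − H(Q(Dσ))`
  rw [← h1]
  abel

/-- **THE FOUR-TERM IDENTITY.**  Under the hypotheses of `eq_source_add_gaugeFix`, for EVERY gauge parameter `σ`: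
`x = C h + C D(Dᵀ(x + D σ)) − (D σ − H(Q(D σ))) + C(S₀(D σ))` — source ∕ divergence of the re-gauged field ∕ known gauge part ∕ tension. [folklore] -/
theorem eq_fourTerm (S S₀ G : E →ₗ[R] E) (Q : E →ₗ[R] F) (Qt : F →ₗ[R] E) (A Dinv : F →ₗ[R] F) (D : Sc →ₗ[R] E) (Dt : E →ₗ[R] Sc)
    (hS : ∀ y : E, S y = S₀ y + D (Dt y) + Qt (A (Q y))) (hGS : ∀ y : E, G (S y) = y) (hD' : ∀ f : F, Dinv (Q (G (Qt f))) = f)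
    {x h : E} {μ : F} (hx : Q x = 0) (hsrc : S₀ x = h + Qt μ) (σ : Sc) :
    x = constrainedGreen G Q Qt Dinv h + constrainedGreen G Q Qt Dinv (D (Dt (x + D σ)))
        - (D σ - G (Qt (Dinv (Q (D σ))))) + constrainedGreen G Q Qt Dinv (S₀ (D σ)) := by
  have h0 := eq_source_add_gaugeFix S S₀ G Q Qt A Dinv D Dt hS hGS hD' hx hsrc
  have h3 := constrainedGreen_gaugeFix_gauge S S₀ G Q Qt A Dinv D Dt hS hGS hD' σ
  have hsplit : constrainedGreen G Q Qt Dinv (D (Dt (x + D σ)))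
      = constrainedGreen G Q Qt Dinv (D (Dt x)) + constrainedGreen G Q Qt Dinv (D (Dt (D σ))) := by
    rw [map_add, map_add, map_add]
  rw [hsplit, h3]
  conv_lhs => rw [h0]
  abel

/-- The four-term identity with the minimiser written as `H f = G(Qᵀ((QGQᵀ)⁻¹ f))` applied to the coarse shadow `f = Q(Dσ)` of the pure gauge: when the average
intertwines gauge transformations (`Q(Dσ) = D_c(σ_c)`, a COARSE pure gauge), the third term is «pure gauge minus the minimal extension of a coarse pure gauge» — at the
flat background itself a pure gauge, so its curl vanishes; at `W` its curl is `ad(flux)` of the generators. (Restatement for the docking files; no new content.) [folklore] -/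
theorem eq_fourTerm' (S S₀ G : E →ₗ[R] E) (Q : E →ₗ[R] F) (Qt : F →ₗ[R] E) (A Dinv : F →ₗ[R] F) (D : Sc →ₗ[R] E) (Dt : E →ₗ[R] Sc)
    (hS : ∀ y : E, S y = S₀ y + D (Dt y) + Qt (A (Q y))) (hGS : ∀ y : E, G (S y) = y) (hD' : ∀ f : F, Dinv (Q (G (Qt f))) = f)
    {x h : E} {μ : F} (hx : Q x = 0) (hsrc : S₀ x = h + Qt μ) (σ : Sc) {f : F} (hf : Q (D σ) = f) :
    x = constrainedGreen G Q Qt Dinv h + constrainedGreen G Q Qt Dinv (D (Dt (x + D σ)))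
        - (D σ - G (Qt (Dinv f))) + constrainedGreen G Q Qt Dinv (S₀ (D σ)) := by
  rw [← hf]
  exact eq_fourTerm S S₀ G Q Qt A Dinv D Dt hS hGS hD' hx hsrc σ

/-! ## §4 Consistency: the right-hand side solves the hard weak equation -/

/-- **WEAK READING** (consistency with (140)'s `pairing_S0_constrainedGreen_eq`): for pairings `B`, `B'` making `Qᵀ` adjoint to `Q`, every `x ∈ ker Q` with `S₀x = h + Qᵀμ`
satisfies `B(S₀ x) y = B h y` on `ker Q` — and so does `C h` by (140); hence `B(S₀(x − C h)) y = 0` on `ker Q`: the three correction terms of `eq_fourTerm` are `S₀`-weakly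
invisible on the slice (they only move the representative within its class, as the letter's `K_X`, `K_D`, `K_Ξ` terms price). [folklore] -/
theorem pairing_S0_sub_source_eq_zero {P : Type*} [AddCommGroup P] [Module R P] (S S₀ G : E →ₗ[R] E) (Q : E →ₗ[R] F) (Qt : F →ₗ[R] E)
    (A' Dinv : F →ₗ[R] F) (hS : ∀ y : E, S y = S₀ y + Qt (A' (Q y))) (hSG : ∀ y : E, S (G y) = y) (hD : ∀ f : F, Q (G (Qt (Dinv f))) = f)
    (B : E →ₗ[R] E →ₗ[R] P) (B' : F →ₗ[R] F →ₗ[R] P) (hadj : ∀ (f : F) (y : E), B (Qt f) y = B' f (Q y))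
    {x h : E} {μ : F} (hsrc : S₀ x = h + Qt μ) {y : E} (hy : Q y = 0) :
    B (S₀ (x - constrainedGreen G Q Qt Dinv h)) y = 0 := by
  have h1 : B (S₀ x) y = B h y := by
    rw [hsrc, map_add, LinearMap.add_apply, hadj, hy, map_zero, add_zero]
  have h2 := NE7ConstrainedGreenIdentity.pairing_S0_constrainedGreen_eq S S₀ G Q Qt A' Dinv hS hSG hD B B' hadj hy h
  rw [map_sub, map_sub, LinearMap.sub_apply, h1, h2, sub_self]

end Summit.QuantumFields.BalabanUV.T4Continuum.NE7ConstrainedGreenGaugeSplit
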